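import Summits.NavierStokesRegularity.NavierStokesRegularity.Theorems.RobustBlowupPortabilityDivFreeTruncationParametric
import Summits.NavierStokesRegularity.NavierStokesRegularity.Theorems.RobustBlowupPortabilityDivFreeTruncationCutoff
import HarnessLib

/-!
# The averaged solenoidal truncation
  (tools for item stmt-NavierStokesRegularity-2928, `RobustBlowupPortability.DivFreeTruncation`)

On `ℝ³ = EuclideanSpace ℝ (Fin 3)`. Given a smooth divergence-free field `V`, a smooth scalar
cut-off `χ` and a smooth weight `θ`, the **averaged truncation** is

  `u x = ∫ a in closedBall 0 r, θ a • T x a`,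
  `T x a = χ(x − a) V(x) + Dχ(x − a)[x − a] F_a(x) − Dχ(x − a)[F_a(x)] (x − a)`,
  `F_a(x) = poincareField (V(· + a)) (x − a) = ∫₀¹ t V(a + t(x − a)) dt`,

i.e. the `θ`-average over the centre `a` of the translated solenoidal truncations of the companion
file `…DivFreeTruncationCutoff`. This file proves the soft properties:

* `contDiff_uncurry_truncationFamily` — `(x, a) ↦ T x a` is jointly smooth;
* `isDivFree_truncationFamily` — each `T · a` is divergence free;
* `contDiff_averagedTruncation`, `isDivFree_averagedTruncation` — `u` is smooth and divergence free
  (differentiation under the integral sign, `…DivFreeTruncationParametric`, trace through the integral);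
* `averagedTruncation_eq_self` — `u = V` on `‖x‖ ≤ ρ` when `χ = 1` on `ball 0 R₁`, `ρ + r < R₁`
  and `∫ θ = 1`;
* `averagedTruncation_eq_zero` — `u = 0` on `R₂ + r < ‖x‖` when `χ = 0` off `ball 0 R₂`;
* `averagedTruncation_eq_smul_add_corrector` — the split `u = (θ ⋆ χ) V + corrector`, the corrector
  written as a double parametric integral of `V` along the segments `[a, x]` against a `V`-free smooth
  kernel, which is the form estimated in the collar file.

Everything is written out explicitly (hypotheses `hT : T = …`, `hu : u = …`), no new definitions.

HONEST FRAMING: vector calculus about arbitrary smooth divergence-free fields; nothing here bears on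
Navier–Stokes regularity.

## References
* G. P. Galdi, *An Introduction to the Mathematical Theory of the Navier–Stokes Equations*, 2nd ed.
  (2011), §III.3.
* M. Costabel, A. McIntosh, *On Bogovskiĭ and regularized Poincaré integral operators for de Rham
  complexes on Lipschitz domains*, Math. Z. 265 (2010) (averaged Poincaré homotopy operators).
-/

noncomputable section

set_option linter.dupNamespace false

namespace Summit.NavierStokesRegularity.NavierStokesRegularity.Theorems

open Set MeasureTheory Filter Topology Function ContinuousLinearMap Module Metric
open scoped ContDiff
open Literature.Analysis.FluidPDE

namespace DivFreeTruncation

/-! ### The family of translated truncations -/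

/-- The translated truncation `T x a` is the cut-off truncation of the translated field `V(· + a)`
evaluated at `x − a`. [folklore] -/
theorem truncationFamily_eq_comp_sub {χ : EuclideanSpace ℝ (Fin 3) → ℝ}
    {V : EuclideanSpace ℝ (Fin 3) → EuclideanSpace ℝ (Fin 3)}
    {T : EuclideanSpace ℝ (Fin 3) → EuclideanSpace ℝ (Fin 3) → EuclideanSpace ℝ (Fin 3)}
    (hT : T = fun x a => χ (x - a) • V x +
      (fderiv ℝ χ (x - a) (x - a)) • poincareField (fun z => V (z + a)) (x - a) -
      (fderiv ℝ χ (x - a) (poincareField (fun z => V (z + a)) (x - a))) • (x - a))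
    (a : EuclideanSpace ℝ (Fin 3)) :
    (fun x => T x a) = (fun y => χ y • V (y + a) +
      (fderiv ℝ χ y y) • poincareField (fun z => V (z + a)) y -
      (fderiv ℝ χ y (poincareField (fun z => V (z + a)) y)) • y) ∘ fun x => x - a := by
  subst hT
  funext x
  simp [sub_add_cancel]

/-- The Poincaré field of the translated field, as a parametric interval integral jointly in
`(x, a)`: `poincareField (V(· + a)) (x − a) = ∫₀¹ t V(t(x − a) + a) dt`. [folklore] -/
theorem poincareField_translate_eq (V : EuclideanSpace ℝ (Fin 3) → EuclideanSpace ℝ (Fin 3))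
    (x a : EuclideanSpace ℝ (Fin 3)) :
    poincareField (fun z => V (z + a)) (x - a) = ∫ t in (0 : ℝ)..1, t • V (t • (x - a) + a) := rfl

/-- Joint smoothness of `(x, a) ↦ poincareField (V(· + a)) (x − a)` for smooth `V`
(smooth integrand over a compact interval, `contDiff_intervalIntegral_of_contDiff`). [folklore] -/
theorem contDiff_poincareField_translate {V : EuclideanSpace ℝ (Fin 3) → EuclideanSpace ℝ (Fin 3)}
    (hV : ContDiff ℝ ∞ V) :
    ContDiff ℝ ∞ fun q : EuclideanSpace ℝ (Fin 3) × EuclideanSpace ℝ (Fin 3) =>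
      poincareField (fun z => V (z + q.2)) (q.1 - q.2) := by
  have h : ContDiff ℝ ∞ (uncurry fun (q : EuclideanSpace ℝ (Fin 3) × EuclideanSpace ℝ (Fin 3))
      (t : ℝ) => t • V (t • (q.1 - q.2) + q.2)) := by
    have : ContDiff ℝ ∞ fun p : (EuclideanSpace ℝ (Fin 3) × EuclideanSpace ℝ (Fin 3)) × ℝ =>
        p.2 • V (p.2 • (p.1.1 - p.1.2) + p.1.2) := by
      fun_prop
    exact this
  exact contDiff_intervalIntegral_of_contDiff h 0 1

/-- **Joint smoothness of the family of translated truncations** `(x, a) ↦ T x a` for smooth `V`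
and smooth cut-off `χ`. [folklore] -/
theorem contDiff_uncurry_truncationFamily {χ : EuclideanSpace ℝ (Fin 3) → ℝ}
    {V : EuclideanSpace ℝ (Fin 3) → EuclideanSpace ℝ (Fin 3)}
    {T : EuclideanSpace ℝ (Fin 3) → EuclideanSpace ℝ (Fin 3) → EuclideanSpace ℝ (Fin 3)}
    (hχ : ContDiff ℝ ∞ χ) (hV : ContDiff ℝ ∞ V)
    (hT : T = fun x a => χ (x - a) • V x +
      (fderiv ℝ χ (x - a) (x - a)) • poincareField (fun z => V (z + a)) (x - a) -
      (fderiv ℝ χ (x - a) (poincareField (fun z => V (z + a)) (x - a))) • (x - a)) :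
    ContDiff ℝ ∞ (uncurry T) := by
  subst hT
  have hsub : ContDiff ℝ ∞ fun q : EuclideanSpace ℝ (Fin 3) × EuclideanSpace ℝ (Fin 3) =>
      q.1 - q.2 := contDiff_fst.sub contDiff_snd
  have hχ' : ContDiff ℝ ∞ fun q : EuclideanSpace ℝ (Fin 3) × EuclideanSpace ℝ (Fin 3) =>
      χ (q.1 - q.2) := hχ.comp hsub
  have hDχ : ContDiff ℝ ∞ (fderiv ℝ χ) := hχ.fderiv_right (by exact_mod_cast le_top)
  have hDχ' : ContDiff ℝ ∞ fun q : EuclideanSpace ℝ (Fin 3) × EuclideanSpace ℝ (Fin 3) =>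
      fderiv ℝ χ (q.1 - q.2) := hDχ.comp hsub
  have hV' : ContDiff ℝ ∞ fun q : EuclideanSpace ℝ (Fin 3) × EuclideanSpace ℝ (Fin 3) =>
      V q.1 := hV.comp contDiff_fst
  have hG := contDiff_poincareField_translate hV
  have h : ContDiff ℝ ∞ fun q : EuclideanSpace ℝ (Fin 3) × EuclideanSpace ℝ (Fin 3) =>
      χ (q.1 - q.2) • V q.1 +
      (fderiv ℝ χ (q.1 - q.2) (q.1 - q.2)) • poincareField (fun z => V (z + q.2)) (q.1 - q.2) -
      (fderiv ℝ χ (q.1 - q.2) (poincareField (fun z => V (z + q.2)) (q.1 - q.2))) •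
        (q.1 - q.2) :=
    ((hχ'.smul hV').add ((hDχ'.clm_apply hsub).smul hG)).sub ((hDχ'.clm_apply hG).smul hsub)
  exact h

/-- **Each translated truncation is divergence free** (`V` smooth and divergence free, `χ` smooth;
dimension `3`): it is a translate of the cut-off truncation of the divergence-free field `V(· + a)`.
[folklore] -/
theorem isDivFree_truncationFamily {χ : EuclideanSpace ℝ (Fin 3) → ℝ}
    {V : EuclideanSpace ℝ (Fin 3) → EuclideanSpace ℝ (Fin 3)}
    {T : EuclideanSpace ℝ (Fin 3) → EuclideanSpace ℝ (Fin 3) → EuclideanSpace ℝ (Fin 3)}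
    (hχ : ContDiff ℝ ∞ χ) (hV : ContDiff ℝ ∞ V) (hdiv : VectorCalculus.IsDivFree V)
    (hT : T = fun x a => χ (x - a) • V x +
      (fderiv ℝ χ (x - a) (x - a)) • poincareField (fun z => V (z + a)) (x - a) -
      (fderiv ℝ χ (x - a) (poincareField (fun z => V (z + a)) (x - a))) • (x - a))
    (a : EuclideanSpace ℝ (Fin 3)) :
    VectorCalculus.IsDivFree fun x => T x a := by
  have hVa : ContDiff ℝ 1 fun z => V (z + a) :=
    (hV.of_le (by exact_mod_cast le_top)).comp (contDiff_id.add contDiff_const)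
  have hdiva : VectorCalculus.IsDivFree fun z => V (z + a) := by
    intro y
    have : VectorCalculus.divergence (fun z => V (z + a)) y = VectorCalculus.divergence V (y + a) := by
      rw [divergence_eq_traceCLM, divergence_eq_traceCLM, fderiv_comp_add_right]
    rw [this]; exact hdiv (y + a)
  have hΨ := isDivFree_cutoffTruncation (χ := χ) (W := fun z => V (z + a))
    finrank_euclideanSpace_fin (contDiff_infty.1 hχ 2) hVa hdiva rfl
  rw [truncationFamily_eq_comp_sub hT a]
  intro x
  have key : ∀ g : EuclideanSpace ℝ (Fin 3) → EuclideanSpace ℝ (Fin 3),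
      VectorCalculus.divergence (g ∘ fun x => x - a) x = VectorCalculus.divergence g (x - a) :=
    fun g => by
      rw [divergence_eq_traceCLM, divergence_eq_traceCLM, Function.comp_def, fderiv_comp_sub]
  rw [key]
  exact hΨ (x - a)

/-- Inside: if `χ = 1` on `ball 0 R₁` and `‖x − a‖ < R₁` then `T x a = V x`. [folklore] -/
theorem truncationFamily_eq_self {χ : EuclideanSpace ℝ (Fin 3) → ℝ}
    {V : EuclideanSpace ℝ (Fin 3) → EuclideanSpace ℝ (Fin 3)}
    {T : EuclideanSpace ℝ (Fin 3) → EuclideanSpace ℝ (Fin 3) → EuclideanSpace ℝ (Fin 3)}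
    (hT : T = fun x a => χ (x - a) • V x +
      (fderiv ℝ χ (x - a) (x - a)) • poincareField (fun z => V (z + a)) (x - a) -
      (fderiv ℝ χ (x - a) (poincareField (fun z => V (z + a)) (x - a))) • (x - a))
    {R₁ : ℝ} (hχ1 : ∀ y ∈ ball (0 : EuclideanSpace ℝ (Fin 3)) R₁, χ y = 1)
    {x a : EuclideanSpace ℝ (Fin 3)} (hxa : ‖x - a‖ < R₁) : T x a = V x := by
  have hloc : χ =ᶠ[𝓝 (x - a)] fun _ => (1 : ℝ) := by
    filter_upwards [isOpen_ball.mem_nhds (mem_ball_zero_iff.2 hxa)] with z hz using hχ1 z hz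
  have h2 : fderiv ℝ χ (x - a) = 0 := fderiv_eq_zero_of_eventuallyEq_const hloc
  have h1 : χ (x - a) = 1 := hχ1 _ (mem_ball_zero_iff.2 hxa)
  subst hT
  simp [h1, h2]

/-- Outside: if `χ = 0` off `ball 0 R₂` and `R₂ < ‖x − a‖` then `T x a = 0`. [folklore] -/
theorem truncationFamily_eq_zero {χ : EuclideanSpace ℝ (Fin 3) → ℝ}
    {V : EuclideanSpace ℝ (Fin 3) → EuclideanSpace ℝ (Fin 3)}
    {T : EuclideanSpace ℝ (Fin 3) → EuclideanSpace ℝ (Fin 3) → EuclideanSpace ℝ (Fin 3)}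
    (hT : T = fun x a => χ (x - a) • V x +
      (fderiv ℝ χ (x - a) (x - a)) • poincareField (fun z => V (z + a)) (x - a) -
      (fderiv ℝ χ (x - a) (poincareField (fun z => V (z + a)) (x - a))) • (x - a))
    {R₂ : ℝ} (hχ0 : ∀ y : EuclideanSpace ℝ (Fin 3), R₂ ≤ ‖y‖ → χ y = 0)
    {x a : EuclideanSpace ℝ (Fin 3)} (hxa : R₂ < ‖x - a‖) : T x a = 0 := by
  have hopen : IsOpen {z : EuclideanSpace ℝ (Fin 3) | R₂ < ‖z‖} :=
    isOpen_lt continuous_const continuous_norm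
  have hloc : χ =ᶠ[𝓝 (x - a)] fun _ => (0 : ℝ) := by
    filter_upwards [hopen.mem_nhds hxa] with z hz using hχ0 z (le_of_lt hz)
  have h2 : fderiv ℝ χ (x - a) = 0 := fderiv_eq_zero_of_eventuallyEq_const hloc
  have h1 : χ (x - a) = 0 := hχ0 _ hxa.le
  subst hT
  simp [h1, h2]

/-! ### The averaged truncation -/

/-- **The averaged truncation is smooth** (smooth integrand, compact parameter set). [folklore] -/
theorem contDiff_averagedTruncation {θ χ : EuclideanSpace ℝ (Fin 3) → ℝ}
    {V : EuclideanSpace ℝ (Fin 3) → EuclideanSpace ℝ (Fin 3)}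
    {T : EuclideanSpace ℝ (Fin 3) → EuclideanSpace ℝ (Fin 3) → EuclideanSpace ℝ (Fin 3)}
    {u : EuclideanSpace ℝ (Fin 3) → EuclideanSpace ℝ (Fin 3)} {r : ℝ}
    (hθ : ContDiff ℝ ∞ θ) (hχ : ContDiff ℝ ∞ χ) (hV : ContDiff ℝ ∞ V)
    (hT : T = fun x a => χ (x - a) • V x +
      (fderiv ℝ χ (x - a) (x - a)) • poincareField (fun z => V (z + a)) (x - a) -
      (fderiv ℝ χ (x - a) (poincareField (fun z => V (z + a)) (x - a))) • (x - a))
    (hu : u = fun x => ∫ a in closedBall (0 : EuclideanSpace ℝ (Fin 3)) r, θ a • T x a) :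
    ContDiff ℝ ∞ u := by
  subst hu
  have hf : ContDiff ℝ ∞ (uncurry fun x a => θ a • T x a) :=
    (hθ.comp contDiff_snd).smul (contDiff_uncurry_truncationFamily hχ hV hT)
  exact contDiff_setIntegral_of_contDiff hf (isCompact_closedBall _ _) volume

/-- **The averaged truncation is divergence free**: `div u (x) = ∫ θ(a) div(T · a)(x) da = 0`
(derivative under the integral sign, trace through the integral). [folklore] -/
theorem isDivFree_averagedTruncation {θ χ : EuclideanSpace ℝ (Fin 3) → ℝ}
    {V : EuclideanSpace ℝ (Fin 3) → EuclideanSpace ℝ (Fin 3)}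
    {T : EuclideanSpace ℝ (Fin 3) → EuclideanSpace ℝ (Fin 3) → EuclideanSpace ℝ (Fin 3)}
    {u : EuclideanSpace ℝ (Fin 3) → EuclideanSpace ℝ (Fin 3)} {r : ℝ}
    (hθ : ContDiff ℝ ∞ θ) (hχ : ContDiff ℝ ∞ χ) (hV : ContDiff ℝ ∞ V)
    (hdiv : VectorCalculus.IsDivFree V)
    (hT : T = fun x a => χ (x - a) • V x +
      (fderiv ℝ χ (x - a) (x - a)) • poincareField (fun z => V (z + a)) (x - a) -
      (fderiv ℝ χ (x - a) (poincareField (fun z => V (z + a)) (x - a))) • (x - a))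
    (hu : u = fun x => ∫ a in closedBall (0 : EuclideanSpace ℝ (Fin 3)) r, θ a • T x a) :
    VectorCalculus.IsDivFree u := by
  subst hu
  set f : EuclideanSpace ℝ (Fin 3) → EuclideanSpace ℝ (Fin 3) → EuclideanSpace ℝ (Fin 3) :=
    fun x a => θ a • T x a with hf_def
  have hf : ContDiff ℝ ∞ (uncurry f) :=
    (hθ.comp contDiff_snd).smul (contDiff_uncurry_truncationFamily hχ hV hT)
  have hf1 : ContDiff ℝ 1 (uncurry f) := hf.of_le (by exact_mod_cast le_top)
  have hS : IsCompact (closedBall (0 : EuclideanSpace ℝ (Fin 3)) r) := isCompact_closedBall _ _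
  intro x
  rw [divergence_eq_traceCLM]
  have hD := fderiv_setIntegral_of_contDiff hf1 hS volume
  rw [show (fun x => ∫ a in closedBall (0 : EuclideanSpace ℝ (Fin 3)) r, θ a • T x a) =
      fun x => ∫ a in closedBall (0 : EuclideanSpace ℝ (Fin 3)) r, f x a from rfl, hD]
  -- trace through the integral
  have hcont : Continuous fun a => (fderiv ℝ (uncurry f) (x, a)).comp
      (inl ℝ (EuclideanSpace ℝ (Fin 3)) (EuclideanSpace ℝ (Fin 3))) :=
    ((hf1.continuous_fderiv one_ne_zero).comp (Continuous.prodMk_right x)).clm_comp continuous_const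
  have hint : Integrable (fun a => (fderiv ℝ (uncurry f) (x, a)).comp
      (inl ℝ (EuclideanSpace ℝ (Fin 3)) (EuclideanSpace ℝ (Fin 3))))
      (volume.restrict (closedBall (0 : EuclideanSpace ℝ (Fin 3)) r)) :=
    hcont.continuousOn.integrableOn_compact hS
  rw [← traceCLM.integral_comp_comm hint]
  have hzero : ∀ a, traceCLM ((fderiv ℝ (uncurry f) (x, a)).comp
      (inl ℝ (EuclideanSpace ℝ (Fin 3)) (EuclideanSpace ℝ (Fin 3)))) = 0 := by
    intro a
    have h1 : (fderiv ℝ (uncurry f) (x, a)).comp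
        (inl ℝ (EuclideanSpace ℝ (Fin 3)) (EuclideanSpace ℝ (Fin 3))) =
        fderiv ℝ (fun y => f y a) x := by
      rw [fderiv_partial_of_contDiff hf1 a]
    have hTd : DifferentiableAt ℝ (fun y => T y a) x :=
      ((contDiff_uncurry_truncationFamily hχ hV hT).comp
        (contDiff_id.prodMk contDiff_const)).differentiable (by simp) x
    have h2 : fderiv ℝ (fun y => f y a) x = θ a • fderiv ℝ (fun y => T y a) x := by
      simp only [hf_def]
      exact fderiv_const_smul hTd (θ a)
    rw [h1, h2, map_smul, ← divergence_eq_traceCLM, isDivFree_truncationFamily hχ hV hdiv hT a x,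
      smul_zero]
  simp [hzero]

/-- **The averaged truncation equals `V` on the inner ball**: if `χ = 1` on `ball 0 R₁`,
`ρ + r < R₁` and `∫_{closedBall 0 r} θ = 1` then `u x = V x` for `‖x‖ ≤ ρ`. [folklore] -/
theorem averagedTruncation_eq_self {θ χ : EuclideanSpace ℝ (Fin 3) → ℝ}
    {V : EuclideanSpace ℝ (Fin 3) → EuclideanSpace ℝ (Fin 3)}
    {T : EuclideanSpace ℝ (Fin 3) → EuclideanSpace ℝ (Fin 3) → EuclideanSpace ℝ (Fin 3)}
    {u : EuclideanSpace ℝ (Fin 3) → EuclideanSpace ℝ (Fin 3)} {r ρ R₁ : ℝ}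
    (hT : T = fun x a => χ (x - a) • V x +
      (fderiv ℝ χ (x - a) (x - a)) • poincareField (fun z => V (z + a)) (x - a) -
      (fderiv ℝ χ (x - a) (poincareField (fun z => V (z + a)) (x - a))) • (x - a))
    (hu : u = fun x => ∫ a in closedBall (0 : EuclideanSpace ℝ (Fin 3)) r, θ a • T x a)
    (hχ1 : ∀ y ∈ ball (0 : EuclideanSpace ℝ (Fin 3)) R₁, χ y = 1) (hR₁ : ρ + r < R₁)
    (hθ1 : ∫ a in closedBall (0 : EuclideanSpace ℝ (Fin 3)) r, θ a = 1)
    {x : EuclideanSpace ℝ (Fin 3)} (hx : ‖x‖ ≤ ρ) : u x = V x := by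
  subst hu
  have heq : ∀ a ∈ closedBall (0 : EuclideanSpace ℝ (Fin 3)) r, θ a • T x a = θ a • V x := by
    intro a ha
    rw [mem_closedBall_zero_iff] at ha
    have hxa : ‖x - a‖ < R₁ :=
      (norm_sub_le x a).trans_lt (by linarith)
    rw [truncationFamily_eq_self hT hχ1 hxa]
  show (∫ a in closedBall (0 : EuclideanSpace ℝ (Fin 3)) r, θ a • T x a) = V x
  rw [setIntegral_congr_fun measurableSet_closedBall heq, integral_smul_const, hθ1, one_smul]

/-- **The averaged truncation vanishes outside**: if `χ = 0` off `ball 0 R₂` then `u x = 0` for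
`R₂ + r < ‖x‖`. [folklore] -/
theorem averagedTruncation_eq_zero {θ χ : EuclideanSpace ℝ (Fin 3) → ℝ}
    {V : EuclideanSpace ℝ (Fin 3) → EuclideanSpace ℝ (Fin 3)}
    {T : EuclideanSpace ℝ (Fin 3) → EuclideanSpace ℝ (Fin 3) → EuclideanSpace ℝ (Fin 3)}
    {u : EuclideanSpace ℝ (Fin 3) → EuclideanSpace ℝ (Fin 3)} {r R₂ : ℝ}
    (hT : T = fun x a => χ (x - a) • V x +
      (fderiv ℝ χ (x - a) (x - a)) • poincareField (fun z => V (z + a)) (x - a) -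
      (fderiv ℝ χ (x - a) (poincareField (fun z => V (z + a)) (x - a))) • (x - a))
    (hu : u = fun x => ∫ a in closedBall (0 : EuclideanSpace ℝ (Fin 3)) r, θ a • T x a)
    (hχ0 : ∀ y : EuclideanSpace ℝ (Fin 3), R₂ ≤ ‖y‖ → χ y = 0)
    {x : EuclideanSpace ℝ (Fin 3)} (hx : R₂ + r < ‖x‖) : u x = 0 := by
  subst hu
  have heq : ∀ a ∈ closedBall (0 : EuclideanSpace ℝ (Fin 3)) r, θ a • T x a = 0 := by
    intro a ha
    rw [mem_closedBall_zero_iff] at ha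
    have hxa : R₂ < ‖x - a‖ := by
      have := norm_sub_norm_le x a
      have h2 : ‖x‖ - ‖a‖ ≤ ‖x - a‖ := by
        have := norm_le_norm_add_norm_sub' x a
        have := norm_sub_le_norm_sub_add_norm_sub x a a
        linarith [norm_sub_norm_le x a, abs_norm_sub_norm_le x a,
          (abs_le.1 (abs_norm_sub_norm_le x a)).1]
      linarith
    rw [truncationFamily_eq_zero hT hχ0 hxa, smul_zero]
  show (∫ a in closedBall (0 : EuclideanSpace ℝ (Fin 3)) r, θ a • T x a) = 0
  rw [setIntegral_congr_fun measurableSet_closedBall heq, integral_zero]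

/-- Outside, all iterated derivatives of the averaged truncation vanish (it is locally zero).
[folklore] -/
theorem iteratedFDeriv_averagedTruncation_eq_zero {θ χ : EuclideanSpace ℝ (Fin 3) → ℝ}
    {V : EuclideanSpace ℝ (Fin 3) → EuclideanSpace ℝ (Fin 3)}
    {T : EuclideanSpace ℝ (Fin 3) → EuclideanSpace ℝ (Fin 3) → EuclideanSpace ℝ (Fin 3)}
    {u : EuclideanSpace ℝ (Fin 3) → EuclideanSpace ℝ (Fin 3)} {r R₂ : ℝ}
    (hT : T = fun x a => χ (x - a) • V x +
      (fderiv ℝ χ (x - a) (x - a)) • poincareField (fun z => V (z + a)) (x - a) -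
      (fderiv ℝ χ (x - a) (poincareField (fun z => V (z + a)) (x - a))) • (x - a))
    (hu : u = fun x => ∫ a in closedBall (0 : EuclideanSpace ℝ (Fin 3)) r, θ a • T x a)
    (hχ0 : ∀ y : EuclideanSpace ℝ (Fin 3), R₂ ≤ ‖y‖ → χ y = 0)
    {x : EuclideanSpace ℝ (Fin 3)} (hx : R₂ + r < ‖x‖) (n : ℕ) : iteratedFDeriv ℝ n u x = 0 := by
  have hopen : IsOpen {z : EuclideanSpace ℝ (Fin 3) | R₂ + r < ‖z‖} :=
    isOpen_lt continuous_const continuous_norm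
  have hloc : u =ᶠ[𝓝 x] fun _ => (0 : EuclideanSpace ℝ (Fin 3)) := by
    filter_upwards [hopen.mem_nhds hx] with z hz using averagedTruncation_eq_zero hT hu hχ0 hz
  rw [(hloc.iteratedFDeriv ℝ n).eq_of_nhds]
  simp

/-! ### Splitting off the corrector -/

/-- **The averaged truncation splits as `(θ ⋆ χ) V + corrector`**, the corrector being the double
parametric integral of `V` along the segments `[a, x]` against the `V`-free kernel
`K(x, a, t) = θ(a) t (Dχ(x − a)[x − a] id − Dχ(x − a) ⊗ (x − a))`:
`u x = (∫ θ(a) χ(x − a) da) V(x) + ∫_{a} ∫₀¹ K(x, a, t)[V(t(x − a) + a)] dt da`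
(the continuous linear map `θ(a)(… id − … ⊗ (x − a))` is taken through the interval integral
defining the Poincaré field). [folklore] -/
theorem averagedTruncation_eq_smul_add_corrector {θ χ : EuclideanSpace ℝ (Fin 3) → ℝ}
    {V : EuclideanSpace ℝ (Fin 3) → EuclideanSpace ℝ (Fin 3)}
    {T : EuclideanSpace ℝ (Fin 3) → EuclideanSpace ℝ (Fin 3) → EuclideanSpace ℝ (Fin 3)}
    {u : EuclideanSpace ℝ (Fin 3) → EuclideanSpace ℝ (Fin 3)} {r : ℝ}
    (hθ : ContDiff ℝ ∞ θ) (hχ : ContDiff ℝ ∞ χ) (hV : ContDiff ℝ ∞ V)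
    (hT : T = fun x a => χ (x - a) • V x +
      (fderiv ℝ χ (x - a) (x - a)) • poincareField (fun z => V (z + a)) (x - a) -
      (fderiv ℝ χ (x - a) (poincareField (fun z => V (z + a)) (x - a))) • (x - a))
    (hu : u = fun x => ∫ a in closedBall (0 : EuclideanSpace ℝ (Fin 3)) r, θ a • T x a)
    (x : EuclideanSpace ℝ (Fin 3)) :
    u x = (∫ a in closedBall (0 : EuclideanSpace ℝ (Fin 3)) r, θ a * χ (x - a)) • V x +
      ∫ a in closedBall (0 : EuclideanSpace ℝ (Fin 3)) r, ∫ t in (0 : ℝ)..1,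
        ((θ a * t) • ((fderiv ℝ χ (x - a) (x - a)) •
            ContinuousLinearMap.id ℝ (EuclideanSpace ℝ (Fin 3)) -
          (fderiv ℝ χ (x - a)).smulRight (x - a))) (V (t • (x - a) + a)) := by
  subst hu
  have hS : IsCompact (closedBall (0 : EuclideanSpace ℝ (Fin 3)) r) := isCompact_closedBall _ _
  have hf : ContDiff ℝ ∞ (uncurry fun x a => θ a • T x a) :=
    (hθ.comp contDiff_snd).smul (contDiff_uncurry_truncationFamily hχ hV hT)
  have hTc : Continuous fun a => θ a • T x a := hf.continuous.comp (Continuous.prodMk_right x)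
  have h1c : Continuous fun a => (θ a * χ (x - a)) • V x :=
    (hθ.continuous.mul (hχ.continuous.comp (continuous_const.sub continuous_id))).smul
      continuous_const
  have hint1 : IntegrableOn (fun a => θ a • T x a) (closedBall 0 r) volume :=
    hTc.continuousOn.integrableOn_compact hS
  have hint2 : IntegrableOn (fun a => (θ a * χ (x - a)) • V x) (closedBall 0 r) volume :=
    h1c.continuousOn.integrableOn_compact hS
  have key : ∀ a, θ a • T x a - (θ a * χ (x - a)) • V x = ∫ t in (0 : ℝ)..1,
      ((θ a * t) • ((fderiv ℝ χ (x - a) (x - a)) •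
          ContinuousLinearMap.id ℝ (EuclideanSpace ℝ (Fin 3)) -
        (fderiv ℝ χ (x - a)).smulRight (x - a))) (V (t • (x - a) + a)) := by
    intro a
    set M : EuclideanSpace ℝ (Fin 3) →L[ℝ] EuclideanSpace ℝ (Fin 3) :=
      (fderiv ℝ χ (x - a) (x - a)) • ContinuousLinearMap.id ℝ (EuclideanSpace ℝ (Fin 3)) -
        (fderiv ℝ χ (x - a)).smulRight (x - a) with hM
    have hTa : θ a • T x a - (θ a * χ (x - a)) • V x =
        (θ a • M) (poincareField (fun z => V (z + a)) (x - a)) := by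
      subst hT
      simp only [hM, _root_.FunLike.coe_smul, _root_.FunLike.coe_sub, Pi.smul_apply,
        Pi.sub_apply, ContinuousLinearMap.id_apply, ContinuousLinearMap.smulRight_apply, smul_add,
        smul_sub, mul_smul]
      abel
    have hGi : IntervalIntegrable (fun t : ℝ => t • V (t • (x - a) + a)) volume 0 1 :=
      (continuous_id.smul (hV.continuous.comp
        ((continuous_id.smul continuous_const).add continuous_const))).intervalIntegrable 0 1
    rw [hTa, poincareField_translate_eq, ← (θ a • M).intervalIntegral_comp_comm hGi]
    congr 1
    funext t
    simp only [_root_.FunLike.coe_smul, Pi.smul_apply, map_smul, smul_smul, mul_comm (θ a) t]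
  have hsplit : (fun a => θ a • T x a) =
      fun a => (θ a * χ (x - a)) • V x + (θ a • T x a - (θ a * χ (x - a)) • V x) := by
    funext a; abel
  have hint3 : IntegrableOn (fun a => θ a • T x a - (θ a * χ (x - a)) • V x) (closedBall 0 r)
      volume := hint1.sub hint2
  show (∫ a in closedBall (0 : EuclideanSpace ℝ (Fin 3)) r, θ a • T x a) = _
  rw [hsplit, integral_add hint2 hint3, integral_smul_const]
  congr 1
  exact setIntegral_congr_fun measurableSet_closedBall fun a _ => key a

end DivFreeTruncation

end Summit.NavierStokesRegularity.NavierStokesRegularity.Theorems
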